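import Mathlib
import Summits.AnomalousDissipation.AnomalousDissipation.Theorems.DyadicWallCascadeViscousContinuationStubNoFastBlowDownHarmonicSliceTools
import HarnessLib

/-!
# Harmonic-endgame tools II (scaling relations) for the rate obstruction `NoFastBlowDown`

Crux `Summit.AnomalousDissipation.AnomalousDissipation.Theses.DyadicWallCascade.ViscousContinuation`
(stmt-AnomalousDissipation-17917, line SketchIdeator4, lead c1).

Second input of the harmonic endgame of the rate obstruction (see
`DyadicWallCascadeViscousContinuationStubNoFastBlowDownHarmonicSliceTools.lean`): for a field
`U : ℝ³ → ℝ³` with `U (2X) = U X` on `1/2 ≤ X₂ ≤ 1` and `1`-periodic in `X₀, X₁` on the band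
`1 ≤ X₂ ≤ 2`, the derived periodicities on the slab `1/2 ≤ X₂ ≤ 2`
(`noFastBlowDown_harm_periodic`) and the SCALING RELATIONS between the heights `3/4` and `3/2`
of the cell averages against `k ⊗ k` (`k` the two-cell partition-of-unity profile):
`g(3/2) = g(3/4)` for the energy `g(z) = ∫ρ ‖U‖²/2` (`noFastBlowDown_harm_scaling_energy`) and
`φ(3/2) = φ(3/4)/2` for the vertical energy flux `φ(z) = ∫ρ ⟪U, ∂₂U⟫`
(`noFastBlowDown_harm_scaling_flux`) — exact cell averaging of `½`-periodic traces
(`noFastBlowDown_cell_half_two`) and the chain rule under the dilation.  The file ends with the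
registered tools stub `stub_noFastBlowDownHarmonicScalingTools`.
-/

open MeasureTheory Set Filter Topology Function
open scoped RealInnerProductSpace

set_option linter.dupNamespace false

noncomputable section

namespace Summit.AnomalousDissipation.AnomalousDissipation.Theorems

/-! ## Coordinate bookkeeping on `ℝ³` -/

/-- Dilating a point: `2 • (x, y, z) = (2x, 2y, 2z)`. [folklore] -/
theorem noFastBlowDown_harm_two_smul_pt (x y z : ℝ) :
    (2 : ℝ) • (!₂[x, y, z] : EuclideanSpace ℝ (Fin 3)) = !₂[2 * x, 2 * y, 2 * z] := by
  ext i; fin_cases i <;> simp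

/-- The height of `(x, y, z)` is `z`. [folklore] -/
theorem noFastBlowDown_harm_pt_two (x y z : ℝ) :
    (!₂[x, y, z] : EuclideanSpace ℝ (Fin 3)) 2 = z := by
  simp

/-! ## Periodicities derived from dilation invariance and band periodicity -/

/-- **Horizontal periods on the slab `1/2 ≤ X₂ ≤ 2`.** If `U (2X) = U X` for `1/2 ≤ X₂ ≤ 1` and
`U` is `1`-periodic in `X₀, X₁` on the band `1 ≤ X₂ ≤ 2`, then `U` is `1`-periodic in `X₀, X₁`
on the whole slab `1/2 ≤ X₂ ≤ 2` and `½`-periodic on `1/2 ≤ X₂ ≤ 1`. [folklore] -/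
theorem noFastBlowDown_harm_periodic (U : EuclideanSpace ℝ (Fin 3) → EuclideanSpace ℝ (Fin 3))
    (hdil : ∀ X : EuclideanSpace ℝ (Fin 3), 1 / 2 ≤ X 2 → X 2 ≤ 1 → U ((2 : ℝ) • X) = U X)
    (hper : ∀ X : EuclideanSpace ℝ (Fin 3), 1 ≤ X 2 → X 2 ≤ 2 →
      U (X + EuclideanSpace.single 0 (1 : ℝ)) = U X ∧ U (X + EuclideanSpace.single 1 (1 : ℝ)) = U X) :
    (∀ X : EuclideanSpace ℝ (Fin 3), 1 / 2 ≤ X 2 → X 2 ≤ 2 →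
      U (X + EuclideanSpace.single 0 (1 : ℝ)) = U X ∧
        U (X + EuclideanSpace.single 1 (1 : ℝ)) = U X) ∧
    (∀ X : EuclideanSpace ℝ (Fin 3), 1 / 2 ≤ X 2 → X 2 ≤ 1 →
      U (X + (1 / 2 : ℝ) • EuclideanSpace.single 0 (1 : ℝ)) = U X ∧
        U (X + (1 / 2 : ℝ) • EuclideanSpace.single 1 (1 : ℝ)) = U X) := by
  have h2 : ∀ X : EuclideanSpace ℝ (Fin 3), ((2 : ℝ) • X) 2 = 2 * X 2 := fun X => by simp
  -- half periods on the lower band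
  have hhalf : ∀ X : EuclideanSpace ℝ (Fin 3), 1 / 2 ≤ X 2 → X 2 ≤ 1 →
      U (X + (1 / 2 : ℝ) • EuclideanSpace.single 0 (1 : ℝ)) = U X ∧
        U (X + (1 / 2 : ℝ) • EuclideanSpace.single 1 (1 : ℝ)) = U X := by
    intro X h1 h1'
    have hb1 : 1 ≤ ((2 : ℝ) • X) 2 := by rw [h2]; linarith
    have hb2 : ((2 : ℝ) • X) 2 ≤ 2 := by rw [h2]; linarith
    constructor
    · have hX' : (X + (1 / 2 : ℝ) • EuclideanSpace.single 0 (1 : ℝ) : EuclideanSpace ℝ (Fin 3)) 2 =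
          X 2 := by simp
      rw [← hdil _ (by rw [hX']; exact h1) (by rw [hX']; exact h1'), smul_add, smul_smul,
        show (2 : ℝ) * (1 / 2) = 1 by norm_num, one_smul, (hper _ hb1 hb2).1, hdil X h1 h1']
    · have hX' : (X + (1 / 2 : ℝ) • EuclideanSpace.single 1 (1 : ℝ) : EuclideanSpace ℝ (Fin 3)) 2 =
          X 2 := by simp
      rw [← hdil _ (by rw [hX']; exact h1) (by rw [hX']; exact h1'), smul_add, smul_smul,
        show (2 : ℝ) * (1 / 2) = 1 by norm_num, one_smul, (hper _ hb1 hb2).2, hdil X h1 h1']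
  refine ⟨fun X h1 h1' => ?_, hhalf⟩
  rcases le_or_gt (X 2) 1 with hle | hgt
  · -- two half periods
    have hA := hhalf X h1 hle
    have hX0 : (X + (1 / 2 : ℝ) • EuclideanSpace.single 0 (1 : ℝ) : EuclideanSpace ℝ (Fin 3)) 2 =
        X 2 := by simp
    have hX1 : (X + (1 / 2 : ℝ) • EuclideanSpace.single 1 (1 : ℝ) : EuclideanSpace ℝ (Fin 3)) 2 =
        X 2 := by simp
    have hB := hhalf (X + (1 / 2 : ℝ) • EuclideanSpace.single 0 (1 : ℝ)) (by rw [hX0]; exact h1)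
      (by rw [hX0]; exact hle)
    have hC := hhalf (X + (1 / 2 : ℝ) • EuclideanSpace.single 1 (1 : ℝ)) (by rw [hX1]; exact h1)
      (by rw [hX1]; exact hle)
    constructor
    · have : X + EuclideanSpace.single 0 (1 : ℝ) =
          X + (1 / 2 : ℝ) • EuclideanSpace.single 0 (1 : ℝ) +
            (1 / 2 : ℝ) • EuclideanSpace.single 0 (1 : ℝ) := by
        rw [add_assoc, ← add_smul]; norm_num
      rw [this, hB.1, hA.1]
    · have : X + EuclideanSpace.single 1 (1 : ℝ) =
          X + (1 / 2 : ℝ) • EuclideanSpace.single 1 (1 : ℝ) +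
            (1 / 2 : ℝ) • EuclideanSpace.single 1 (1 : ℝ) := by
        rw [add_assoc, ← add_smul]; norm_num
      rw [this, hC.2, hA.2]
  · exact hper X hgt.le h1'

/-! ## The scaling relations between the heights `3/4` and `3/2` -/

/-- **Scaling of the averaged energy.**  If `U (2X) = U X` for `1/2 ≤ X₂ ≤ 1` and `U` is
`1`-periodic in `X₀, X₁` on the band `1 ≤ X₂ ≤ 2`, then the cell average of `‖U‖²/2` against
`k ⊗ k` is the same at the heights `3/2` and `3/4`: the trace at `3/2` is the trace at `3/4`
composed with `q ↦ q/2`, and the latter is `½`-periodic, so the exact cell averaging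
`noFastBlowDown_cell_half_two` applies. [folklore] -/
theorem noFastBlowDown_harm_scaling_energy
    (U : EuclideanSpace ℝ (Fin 3) → EuclideanSpace ℝ (Fin 3)) (hUc : Continuous U)
    (hdil : ∀ X : EuclideanSpace ℝ (Fin 3), 1 / 2 ≤ X 2 → X 2 ≤ 1 → U ((2 : ℝ) • X) = U X)
    (hper : ∀ X : EuclideanSpace ℝ (Fin 3), 1 ≤ X 2 → X 2 ≤ 2 →
      U (X + EuclideanSpace.single 0 (1 : ℝ)) = U X ∧ U (X + EuclideanSpace.single 1 (1 : ℝ)) = U X)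
    (k : ℝ → ℝ) (hk : Continuous k) (hk0 : ∀ t, t ≤ 0 → k t = 0)
    (hk2 : ∀ t, 2 ≤ t → k t = 0) (hk1 : ∀ t, 0 ≤ t → t ≤ 1 → k t + k (t + 1) = 1) :
    ∫ q : ℝ × ℝ, k q.1 * k q.2 * (‖U !₂[q.1, q.2, 3 / 2]‖ ^ 2 / 2) =
      ∫ q : ℝ × ℝ, k q.1 * k q.2 * (‖U !₂[q.1, q.2, 3 / 4]‖ ^ 2 / 2) := by
  obtain ⟨-, hhalf⟩ := noFastBlowDown_harm_periodic U hdil hper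
  set h : ℝ × ℝ → ℝ := fun q => ‖U !₂[q.1, q.2, 3 / 4]‖ ^ 2 / 2 with hh
  have hhc : Continuous h := by
    simp only [hh]
    fun_prop
  -- the trace at height `3/2` is the rescaled trace at height `3/4`
  have htrace : ∀ q : ℝ × ℝ, ‖U !₂[q.1, q.2, 3 / 2]‖ ^ 2 / 2 = h (q.1 / 2, q.2 / 2) := by
    intro q
    simp only [hh]
    have hX : (!₂[q.1 / 2, q.2 / 2, 3 / 4] : EuclideanSpace ℝ (Fin 3)) 2 = 3 / 4 := by simp
    have := hdil (!₂[q.1 / 2, q.2 / 2, 3 / 4]) (by rw [hX]; norm_num) (by rw [hX]; norm_num)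
    rw [noFastBlowDown_harm_two_smul_pt] at this
    rw [show (2 : ℝ) * (q.1 / 2) = q.1 by ring, show (2 : ℝ) * (q.2 / 2) = q.2 by ring,
      show (2 : ℝ) * (3 / 4) = 3 / 2 by norm_num] at this
    rw [this]
  -- `h` is `½`-periodic in both variables
  have hX34 : ∀ a b : ℝ, (!₂[a, b, 3 / 4] : EuclideanSpace ℝ (Fin 3)) 2 = 3 / 4 := fun a b => by simp
  have hper1 : ∀ q : ℝ × ℝ, h (q.1 + 1 / 2, q.2) = h q := fun q => by
    simp only [hh]
    rw [← noFastBlowDown_harm_pt_add_zero q.1 q.2 (3 / 4) (1 / 2),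
      (hhalf _ (by rw [hX34]; norm_num) (by rw [hX34]; norm_num)).1]
  have hper2 : ∀ q : ℝ × ℝ, h (q.1, q.2 + 1 / 2) = h q := fun q => by
    simp only [hh]
    rw [← noFastBlowDown_harm_pt_add_one q.1 q.2 (3 / 4) (1 / 2),
      (hhalf _ (by rw [hX34]; norm_num) (by rw [hX34]; norm_num)).2]
  have key := noFastBlowDown_cell_half_two k h hk hhc hk0 hk2 hk1 hper1 hper2
  calc ∫ q : ℝ × ℝ, k q.1 * k q.2 * (‖U !₂[q.1, q.2, 3 / 2]‖ ^ 2 / 2)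
      = ∫ q : ℝ × ℝ, k q.1 * k q.2 * h (q.1 / 2, q.2 / 2) :=
        integral_congr_ae (Eventually.of_forall fun q => by simp only [htrace])
    _ = ∫ q : ℝ × ℝ, k q.1 * k q.2 * h q := key

/-- **Scaling of the averaged vertical energy flux.**  Under the same hypotheses and with `U`
differentiable, the cell average of `⟪U, ∂₂U⟫` at height `3/2` is HALF the one at height `3/4`:
near the plane `X₂ = 3/2` one has `U = U ∘ (½ •)`, so `∂₂U (x, y, 3/2) = ½ ∂₂U (x/2, y/2, 3/4)`
(chain rule), and the trace `⟪U, ∂₂U⟫ (·, 3/4)` is `½`-periodic (derivatives of `U` inherit the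
half periods on the open lower band). [folklore] -/
theorem noFastBlowDown_harm_scaling_flux
    (U : EuclideanSpace ℝ (Fin 3) → EuclideanSpace ℝ (Fin 3))
    (hU : ContDiff ℝ ((⊤ : ℕ∞) : WithTop ℕ∞) U)
    (hdil : ∀ X : EuclideanSpace ℝ (Fin 3), 1 / 2 ≤ X 2 → X 2 ≤ 1 → U ((2 : ℝ) • X) = U X)
    (hper : ∀ X : EuclideanSpace ℝ (Fin 3), 1 ≤ X 2 → X 2 ≤ 2 →
      U (X + EuclideanSpace.single 0 (1 : ℝ)) = U X ∧ U (X + EuclideanSpace.single 1 (1 : ℝ)) = U X)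
    (k : ℝ → ℝ) (hk : Continuous k) (hk0 : ∀ t, t ≤ 0 → k t = 0)
    (hk2 : ∀ t, 2 ≤ t → k t = 0) (hk1 : ∀ t, 0 ≤ t → t ≤ 1 → k t + k (t + 1) = 1) :
    ∫ q : ℝ × ℝ, k q.1 * k q.2 * ⟪U !₂[q.1, q.2, 3 / 2],
        fderiv ℝ U !₂[q.1, q.2, 3 / 2] (EuclideanSpace.single 2 (1 : ℝ))⟫ =
      (1 / 2 : ℝ) * ∫ q : ℝ × ℝ, k q.1 * k q.2 * ⟪U !₂[q.1, q.2, 3 / 4],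
        fderiv ℝ U !₂[q.1, q.2, 3 / 4] (EuclideanSpace.single 2 (1 : ℝ))⟫ := by
  set e2 : EuclideanSpace ℝ (Fin 3) := EuclideanSpace.single 2 (1 : ℝ) with he2
  obtain ⟨-, hhalf⟩ := noFastBlowDown_harm_periodic U hdil hper
  have hUc : Continuous U := hU.continuous
  have hDc : Continuous fun Y => fderiv ℝ U Y e2 :=
    (noFastBlowDown_weyl_contDiff_fderiv_apply hU e2).continuous
  set h : ℝ × ℝ → ℝ := fun q => ⟪U !₂[q.1, q.2, 3 / 4], fderiv ℝ U !₂[q.1, q.2, 3 / 4] e2⟫ with hh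
  have hhc : Continuous h := by
    simp only [hh]
    fun_prop
  -- `U = U ∘ (½ •)` on the open slab `1 < X₂ < 2`
  have hslab : ∀ X : EuclideanSpace ℝ (Fin 3), 1 < X 2 → X 2 < 2 →
      U X = (fun Y : EuclideanSpace ℝ (Fin 3) => U ((2 : ℝ)⁻¹ • Y)) X := by
    intro X h1 h2
    have hY : ((2 : ℝ)⁻¹ • X) 2 = 2⁻¹ * X 2 := by simp
    have := hdil ((2 : ℝ)⁻¹ • X) (by rw [hY]; linarith) (by rw [hY]; linarith)
    rw [smul_smul, mul_inv_cancel₀ two_ne_zero, one_smul] at this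
    exact this
  -- the chain rule for the derivative at height `3/2`
  have hderiv : ∀ q : ℝ × ℝ, fderiv ℝ U !₂[q.1, q.2, 3 / 2] e2 =
      (1 / 2 : ℝ) • fderiv ℝ U !₂[q.1 / 2, q.2 / 2, 3 / 4] e2 := by
    intro q
    have hX : (!₂[q.1, q.2, 3 / 2] : EuclideanSpace ℝ (Fin 3)) 2 = 3 / 2 := by simp
    have hc := (noFastBlowDown_weyl_fderiv_congr U (fun Y => U ((2 : ℝ)⁻¹ • Y)) 1 2 hslab
      (!₂[q.1, q.2, 3 / 2]) (by rw [hX]; norm_num) (by rw [hX]; norm_num)).1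
    rw [hc, fderiv_comp_smul (2 : ℝ)⁻¹, FunLike.coe_smul, Pi.smul_apply]
    have hpt : (2 : ℝ)⁻¹ • (!₂[q.1, q.2, 3 / 2] : EuclideanSpace ℝ (Fin 3)) =
        !₂[q.1 / 2, q.2 / 2, 3 / 4] := by
      ext i; fin_cases i <;> simp <;> ring
    rw [hpt, one_div]
  -- the trace of `U` at height `3/2`
  have hval : ∀ q : ℝ × ℝ, U !₂[q.1, q.2, 3 / 2] = U !₂[q.1 / 2, q.2 / 2, 3 / 4] := by
    intro q
    have hX : (!₂[q.1 / 2, q.2 / 2, 3 / 4] : EuclideanSpace ℝ (Fin 3)) 2 = 3 / 4 := by simp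
    have := hdil (!₂[q.1 / 2, q.2 / 2, 3 / 4]) (by rw [hX]; norm_num) (by rw [hX]; norm_num)
    rw [noFastBlowDown_harm_two_smul_pt] at this
    rw [show (2 : ℝ) * (q.1 / 2) = q.1 by ring, show (2 : ℝ) * (q.2 / 2) = q.2 by ring,
      show (2 : ℝ) * (3 / 4) = 3 / 2 by norm_num] at this
    exact this
  have htrace : ∀ q : ℝ × ℝ, ⟪U !₂[q.1, q.2, 3 / 2], fderiv ℝ U !₂[q.1, q.2, 3 / 2] e2⟫ =
      (1 / 2 : ℝ) * h (q.1 / 2, q.2 / 2) := by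
    intro q
    rw [hderiv, hval, real_inner_smul_right]
  -- `h` is `½`-periodic: derivatives inherit the half periods on the open lower band
  have hX34 : ∀ a b : ℝ, (!₂[a, b, 3 / 4] : EuclideanSpace ℝ (Fin 3)) 2 = 3 / 4 := fun a b => by simp
  have hopen0 : ∀ X : EuclideanSpace ℝ (Fin 3), 1 / 2 < X 2 → X 2 < 1 →
      U X = (fun Y => U (Y + (1 / 2 : ℝ) • EuclideanSpace.single 0 (1 : ℝ))) X :=
    fun X h1 h2 => ((hhalf X h1.le h2.le).1).symm
  have hopen1 : ∀ X : EuclideanSpace ℝ (Fin 3), 1 / 2 < X 2 → X 2 < 1 →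
      U X = (fun Y => U (Y + (1 / 2 : ℝ) • EuclideanSpace.single 1 (1 : ℝ))) X :=
    fun X h1 h2 => ((hhalf X h1.le h2.le).2).symm
  have hper1 : ∀ q : ℝ × ℝ, h (q.1 + 1 / 2, q.2) = h q := fun q => by
    simp only [hh]
    have hpt := noFastBlowDown_harm_pt_add_zero q.1 q.2 (3 / 4) (1 / 2)
    have hc := (noFastBlowDown_weyl_fderiv_congr U _ (1 / 2) 1 hopen0 (!₂[q.1, q.2, 3 / 4])
      (by rw [hX34]; norm_num) (by rw [hX34]; norm_num)).1
    rw [fderiv_comp_add_right] at hc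
    rw [← hpt, ← hc, (hhalf _ (by rw [hX34]; norm_num) (by rw [hX34]; norm_num)).1]
  have hper2 : ∀ q : ℝ × ℝ, h (q.1, q.2 + 1 / 2) = h q := fun q => by
    simp only [hh]
    have hpt := noFastBlowDown_harm_pt_add_one q.1 q.2 (3 / 4) (1 / 2)
    have hc := (noFastBlowDown_weyl_fderiv_congr U _ (1 / 2) 1 hopen1 (!₂[q.1, q.2, 3 / 4])
      (by rw [hX34]; norm_num) (by rw [hX34]; norm_num)).1
    rw [fderiv_comp_add_right] at hc
    rw [← hpt, ← hc, (hhalf _ (by rw [hX34]; norm_num) (by rw [hX34]; norm_num)).2]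
  have key := noFastBlowDown_cell_half_two k h hk hhc hk0 hk2 hk1 hper1 hper2
  calc ∫ q : ℝ × ℝ, k q.1 * k q.2 * ⟪U !₂[q.1, q.2, 3 / 2], fderiv ℝ U !₂[q.1, q.2, 3 / 2] e2⟫
      = ∫ q : ℝ × ℝ, (1 / 2 : ℝ) * (k q.1 * k q.2 * h (q.1 / 2, q.2 / 2)) :=
        integral_congr_ae (Eventually.of_forall fun q => by simp only [htrace]; ring)
    _ = (1 / 2 : ℝ) * ∫ q : ℝ × ℝ, k q.1 * k q.2 * h q := by rw [integral_const_mul, key]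

/-! ## The registered tools stub -/

/-- **Harmonic-endgame tools II (registered stub).** Conjunction of the derived periodicities,
the two scaling relations and the two coordinate identities of this file. [folklore] -/
theorem stub_noFastBlowDownHarmonicScalingTools :
    (∀ (U : EuclideanSpace ℝ (Fin 3) → EuclideanSpace ℝ (Fin 3)),
      (∀ X : EuclideanSpace ℝ (Fin 3), 1 / 2 ≤ X 2 → X 2 ≤ 1 → U ((2 : ℝ) • X) = U X) →
      (∀ X : EuclideanSpace ℝ (Fin 3), 1 ≤ X 2 → X 2 ≤ 2 →
        U (X + EuclideanSpace.single 0 (1 : ℝ)) = U X ∧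
          U (X + EuclideanSpace.single 1 (1 : ℝ)) = U X) →
      (∀ X : EuclideanSpace ℝ (Fin 3), 1 / 2 ≤ X 2 → X 2 ≤ 2 →
        U (X + EuclideanSpace.single 0 (1 : ℝ)) = U X ∧
          U (X + EuclideanSpace.single 1 (1 : ℝ)) = U X) ∧
      (∀ X : EuclideanSpace ℝ (Fin 3), 1 / 2 ≤ X 2 → X 2 ≤ 1 →
        U (X + (1 / 2 : ℝ) • EuclideanSpace.single 0 (1 : ℝ)) = U X ∧
          U (X + (1 / 2 : ℝ) • EuclideanSpace.single 1 (1 : ℝ)) = U X)) ∧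
    (∀ (U : EuclideanSpace ℝ (Fin 3) → EuclideanSpace ℝ (Fin 3)), Continuous U →
      (∀ X : EuclideanSpace ℝ (Fin 3), 1 / 2 ≤ X 2 → X 2 ≤ 1 → U ((2 : ℝ) • X) = U X) →
      (∀ X : EuclideanSpace ℝ (Fin 3), 1 ≤ X 2 → X 2 ≤ 2 →
        U (X + EuclideanSpace.single 0 (1 : ℝ)) = U X ∧
          U (X + EuclideanSpace.single 1 (1 : ℝ)) = U X) →
      ∀ (k : ℝ → ℝ), Continuous k → (∀ t, t ≤ 0 → k t = 0) → (∀ t, 2 ≤ t → k t = 0) →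
      (∀ t, 0 ≤ t → t ≤ 1 → k t + k (t + 1) = 1) →
      ∫ q : ℝ × ℝ, k q.1 * k q.2 * (‖U !₂[q.1, q.2, 3 / 2]‖ ^ 2 / 2) =
        ∫ q : ℝ × ℝ, k q.1 * k q.2 * (‖U !₂[q.1, q.2, 3 / 4]‖ ^ 2 / 2)) ∧
    (∀ (U : EuclideanSpace ℝ (Fin 3) → EuclideanSpace ℝ (Fin 3)),
      ContDiff ℝ ((⊤ : ℕ∞) : WithTop ℕ∞) U →
      (∀ X : EuclideanSpace ℝ (Fin 3), 1 / 2 ≤ X 2 → X 2 ≤ 1 → U ((2 : ℝ) • X) = U X) →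
      (∀ X : EuclideanSpace ℝ (Fin 3), 1 ≤ X 2 → X 2 ≤ 2 →
        U (X + EuclideanSpace.single 0 (1 : ℝ)) = U X ∧
          U (X + EuclideanSpace.single 1 (1 : ℝ)) = U X) →
      ∀ (k : ℝ → ℝ), Continuous k → (∀ t, t ≤ 0 → k t = 0) → (∀ t, 2 ≤ t → k t = 0) →
      (∀ t, 0 ≤ t → t ≤ 1 → k t + k (t + 1) = 1) →
      ∫ q : ℝ × ℝ, k q.1 * k q.2 * inner ℝ (U !₂[q.1, q.2, 3 / 2])
          (fderiv ℝ U !₂[q.1, q.2, 3 / 2] (EuclideanSpace.single 2 (1 : ℝ))) =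
        (1 / 2 : ℝ) * ∫ q : ℝ × ℝ, k q.1 * k q.2 * inner ℝ (U !₂[q.1, q.2, 3 / 4])
          (fderiv ℝ U !₂[q.1, q.2, 3 / 4] (EuclideanSpace.single 2 (1 : ℝ)))) ∧
    (∀ x y z : ℝ, (2 : ℝ) • (!₂[x, y, z] : EuclideanSpace ℝ (Fin 3)) = !₂[2 * x, 2 * y, 2 * z]) ∧
    (∀ x y z : ℝ, (!₂[x, y, z] : EuclideanSpace ℝ (Fin 3)) 2 = z) :=
  ⟨noFastBlowDown_harm_periodic, noFastBlowDown_harm_scaling_energy,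
    noFastBlowDown_harm_scaling_flux, noFastBlowDown_harm_two_smul_pt, noFastBlowDown_harm_pt_two⟩

end Summit.AnomalousDissipation.AnomalousDissipation.Theorems

end
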